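import Summits.ABC.IUTFork.Cor312ThetaSideEqualM
import Summits.ABC.IUTFork.Cor312ThetaSlotLocalLeContentHull
import Summits.ABC.IUTFork.Cor312ThetaSlotLocalGeContentHull
import HarnessLib

/-!
# [IUTchIII] Corollary 3.12 IN READING (P) at the M-LEVEL sharp setting (summand route, genuine carriers `K_{v̲}`) — the SLOT-HULL local
# term IS the last-slot orbit-hull sum: `−|log(Θ)|^{(P)}_{i+1,u} = Σ_{v⃗'} Pr(v⃗')·log μ̄_{v⃗'}(hull(Ind2·ι_{i+1}(t_{Θ,i+1,v̲'_{i+1}})·(R_I)^∼))`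
# (ANY non-zero Θ-ideles, units off a finite set of rational places)

PROOF-ONLY file (D-0012; no definitions, no `Prop` facts) of the abc-iut cell (branch C certificate seat abc-iut-C-cert-2 gen 4; the M-LEVEL
SLOT READ left open at gen 3's close: «the M-line γ/joint twins need an M-level slot READ — s2-p7's `Cor312ThetaSlotExactK` method at
`settingPrVolSharpM`»). TAKES NO SIDE on [IUTchIII] Cor. 3.12 or on the reading (U)/(P) of `−|log(Θ)|`.

The M-level twin of abc-iut-s2-p7's `Cor312PilotIdelesPrSlotHull` (p458886, `K`-level print-normalised sharp setting): at abc-iut-s2-p8's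
summand-route M-level sharp setting `Real.settingPrVolSharpM D hlog t tq …` ([IUTchI] Def. 3.1 (e) carriers `K_{v̲}`, `v̲ ∈ V̲`; packet-normalised
volumes `weightM`; SHARP Dupuy–Hilado Θ-boxes read off Θ-ideles `t`), abc-iut-C-cert-2's reading-(P) quantities of `Cor312SlotHull` (p458847:
`thetaSlotImages` = the (Ind2)-translates of the (Ind3)-region ONLY, `thetaSlotHull`, `thetaSlotLocal`, `negLogThetaSlot`) are COMPUTED, by
instantiating abc-iut-s2-p7's GENERIC slot bounds (`Cor312ThetaSlotLocalLeContentHull` / `Cor312ThetaSlotLocalGeContentHull`) with the M-level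
dischargers already in the tree — `hframe := rfl` (abc-iut-s2-p8 `frame_settingPrVolSharpM_non`), `hvol :=` abc-iut-c312-5's
`SummandPieces.logvol_preimage_pi` (`logvol_situationPrVolM_preimage_pi`), `hmono`/`HullDefined` from abc-iut-s2-p8's `BridgeHyps`
(`bridgeHyps_settingPrVolSharpM_of_ideles`), the region = the product of the LAST-slot sharp boxes (abc-iut-s2-p9
`thetaRegion3_settingPrVolSharpM_eq_preimage_pi`), and FULLNESS of Ism at the genuine carriers (abc-iut-s2-p9
`exists_ism_presAtM_of_image_logUnits_eq`, Dupuy–Hilado §4.9):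

* §1 `slotHullDefined_settingPrVolSharpM_arc` / `_non` (the slot union is relatively compact inside the full union and nondegenerate: it
  contains the region, whose image under the ONTO field-factor comparison is the hull-set `λ_Θ·𝒪_L`, abc-iut-s2-p8 `isHullSet_thetaBoxM_non`);
  `thetaSlotLocal_settingPrVolSharpM_arc_eq_zero` (trivial archimedean container);
* §2 **`thetaSlotLocal_settingPrVolSharpM_untopD_le_sum_content_hull`** (ANY family `m` bracketing the last-slot boxes from above — NO capsule
  symmetry, NO condition on the other slots) / **`sum_content_hull_le_thetaSlotLocal_settingPrVolSharpM_untopD`** (EXACT `m`) /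
  **`thetaSlotLocal_settingPrVolSharpM_eq_sum_content_hull`** (EQUALITY) / **`thetaSlotLocal_settingPrVolSharpM_eq_sum_orbitHull`** — the
  hypothesis-free ORBIT form: summand by summand Dupuy–Hilado's PER-SLOT-IMAGE shape (abc-iut-S7 `PrimePacket.slotImagesHull`) at the genuine
  carriers; print's factorwise (Ind2) and the full lattice group `Aut_{ℚ_p}(K_{v̲} : I_{v̲})` give the SAME per-image volume.

USE (sequel, this seat): at the datum's OWN Θ-ideles `tOfIdeleData D r` the orbit form is abc-iut-S7's per-image number summand by summand, whence
`negLogThetaSlot (settingPrVolSharpM …) = ↑(volumeInputOf D r).negLogThetaPerImageNonarch` — the READ-P binder of the γ/joint certificates on the M line.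
[cite: Mochizuki2012, IUTchIII Thm. 3.11 (i) (Ind2) p. 154; Cor. 3.12 proof Step (x) p. 181; Rmk. 3.9.5 (i) p. 127] [cite: Mochizuki2012, IUTchIV
Thm. 1.10 Step (v) p. 27–28] [cite: Mochizuki2012, IUTchI Def. 3.1 (e) p. 62] [cite: DupuyHilado2025, §3.7, §3.9, §4.9, §4.11–4.12]
[claim: Mochizuki2012, status: disputed] for every quoted construction. HONEST FRAMING: identities between OUR typed objects at ONE instantiation
(sharp (Ind3) reading, factorwise (Ind2), trivial archimedean container); reading (P) is STRONGER than print's hull of the union of ALL possible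
images; nothing here asserts or denies Cor. 3.12 for any initial Θ-data or takes a side on any author; typed ≠ proved; instantiated ≠ endorsed.
-/

noncomputable section

open Set Function NumberField IsDedekindDomain
open scoped Pointwise

namespace Summit.ABC.IUTFork.Thm311.Real

open Cor312 Cor312Vol Literature.IUT.LogThetaLattice Literature.IUT.LogVolume Literature.IUT.HodgeTheaters
  Literature.NumberTheory.NumberFields

variable {F K Fbar : Type} [Field F] [NumberField F] [Field K] [NumberField K] [Algebra F K]
  [Field Fbar] [Algebra F Fbar] [Algebra K Fbar] {E : WeierstrassCurve F} [E.IsElliptic] {l : ℕ}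
  {Pb : BadPlacePredicates K} (D : InitialThetaData F K Fbar E l Pb) {logvK : PadicLogsVal K}
  (hlog : LogvAnalyticVal logvK)
  (t : ∀ (u : FinitePlace ℚ) (_ : Fin (thetaIndexOfInitial D).lstar) (x : (thetaIndexOfInitial D).Fibre (Val.non u)),
    kOfM D (ratChar u) u (natCast_ratChar_mem u) x)
  (tq : ∀ (u : FinitePlace ℚ) (x : (thetaIndexOfInitial D).Fibre (Val.non u)),
    kOfM D (ratChar u) u (natCast_ratChar_mem u) x)
  (M : Type) [Field M] [NumberField M]
  (archPk : ∀ (j : (thetaIndexOfInitial D).Label) (vQ : (thetaIndexOfInitial D).VQ),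
    Set ((logShellsOfInitialDH D logvK).Packet j vQ))
  (archSub : ∀ (j : (thetaIndexOfInitial D).Label) (v : (thetaIndexOfInitial D).V),
    Set ((logShellsOfInitialDH D logvK).Packet j ((thetaIndexOfInitial D).over v)))
  (Ψ : ℤ → ∀ v : (thetaIndexOfInitial D).V, v ∈ (thetaIndexOfInitial D).Vbad →
    Set ((logShellsOfInitialDH D logvK).StarPacket v))
  (act : ℤ → ∀ v : (thetaIndexOfInitial D).V, v ∈ (thetaIndexOfInitial D).Vbad →
    (logShellsOfInitialDH D logvK).StarPacket v → Module.End ℚ ((logShellsOfInitialDH D logvK).StarPacket v))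
  (Mmod : ℤ → ∀ j : (thetaIndexOfInitial D).LabelStar, Set ((logShellsOfInitialDH D logvK).GlobalPacket j.1))
  (region : ℤ → ∀ j : (thetaIndexOfInitial D).LabelStar, FinDivisor M → ∀ vQ : (thetaIndexOfInitial D).VQ,
    Set ((logShellsOfInitialDH D logvK).Packet j.1 vQ))
  (n : ℤ) {HT : Type} {LogLink : HT → HT → Type} {IsFull : ∀ {s t : HT}, LogLink s t → Prop}
  (lat : LGPGaussianLogThetaLattice LogLink IsFull)
  {Frd : Type} {IsoF : Frd → Frd → Type} {Ob : Frd → Type} {realify : Frd → Frd} {Strip : Type}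
  {IsoS : Strip → Strip → Type}
  {Mv : ∀ v : (thetaIndexOfInitial D).V, v ∈ (thetaIndexOfInitial D).Vbad → Type} [∀ v h, Monoid (Mv v h)]
  (sig : GlobalLGPFrobenioidSignature (thetaIndexOfInitial D).lstar (thetaIndexOfInitial D).V
    (· ∈ (thetaIndexOfInitial D).Vbad) Frd IsoF Ob realify Strip IsoS Mv)
  (split : SplittingMonoids Mv) {ObΔ : Type}
  {N : ∀ v : (thetaIndexOfInitial D).V, v ∈ (thetaIndexOfInitial D).Vbad → Type} [∀ v h, Monoid (N v h)]
  (qData : QPilotData ObΔ N)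
  (htq0 : ∀ u x, tq u x ≠ 0) (Sq : Finset (FinitePlace ℚ))
  (htq1 : ∀ (u : FinitePlace ℚ) (x : (thetaIndexOfInitial D).Fibre (Val.non u)), u ∉ Sq → ‖tq u x‖ = 1)

/-! ## §1. `SlotHullDefined` everywhere; the slot term vanishes at `∞` -/

/-- **`SlotHullDefined` at `v_ℚ = ∞`, UNCONDITIONALLY** (empty field-factor index: the trivial archimedean container; twin of abc-iut-s2-p7's
`slotHullDefined_settingPrVolSharp_inl`). [claim: Mochizuki2012, status: disputed] -/
theorem slotHullDefined_settingPrVolSharpM_arc (j : (thetaIndexOfInitial D).Label) (w : InfinitePlace ℚ) :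
    (settingPrVolSharpM D hlog t tq M archPk archSub Ψ act Mmod region n lat sig split qData htq0 Sq htq1).SlotHullDefined j
      (Val.arc w) := by
  refine ⟨isBounded_iff_forall_norm_le.2 ⟨0, fun z _ => (pi_norm_le_iff_of_nonneg le_rfl).2 fun s => s.elim⟩,
    fun s => s.elim⟩

/-- **`SlotHullDefined` at a finite rational place `u`** for non-zero Θ-ideles that are units off a finite set `Sθ`: the slot union is relatively
compact (inside the full union, `HullDefined` by abc-iut-s2-p8's `BridgeHyps`) and nondegenerate (it contains the (Ind3)-region, whose image under
the ONTO field-factor comparison is the hull-set `λ_Θ·𝒪_L`, abc-iut-s2-p8 `isHullSet_thetaBoxM_non`). Twin of abc-iut-s2-p7's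
`slotHullDefined_settingPrVolSharp_inr`. [cite: Mochizuki2012, IUTchIII Rmk. 3.9.5 (i) p. 127] [cite: DupuyHilado2025, §3.9, §4.11] -/
theorem slotHullDefined_settingPrVolSharpM_non (ht0 : ∀ u i x, t u i x ≠ 0) (Sθ : Finset (FinitePlace ℚ))
    (ht1 : ∀ (u : FinitePlace ℚ) (i : Fin (thetaIndexOfInitial D).lstar) (x : (thetaIndexOfInitial D).Fibre (Val.non u)),
      u ∉ Sθ → ‖t u i x‖ = 1)
    (i : Fin (thetaIndexOfInitial D).lstar) (u : FinitePlace ℚ) :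
    (settingPrVolSharpM D hlog t tq M archPk archSub Ψ act Mmod region n lat sig split qData htq0 Sq htq1).SlotHullDefined
      (Setting.labelSucc i) (Val.non u) := by
  refine (settingPrVolSharpM D hlog t tq M archPk archSub Ψ act Mmod region n lat sig split qData htq0 Sq htq1).slotHullDefined_of_hullDefined
    (hullDefined_of_finite (bridgeHyps_settingPrVolSharpM_of_ideles D hlog t tq M archPk archSub Ψ act Mmod region n lat sig split qData
      htq0 Sq htq1 ht0 Sθ ht1) i _) ?_
  -- nondegenerate: the image of the region under the onto comparison is the hull-set `λ_Θ·𝒪_L`, and the slot union contains the region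
  have hnd : IsNondegenerate (factorFieldM D hlog (Setting.labelSucc i) (Val.non u))
      (factorMapM D hlog (Setting.labelSucc i) (Val.non u) ''
        (settingPrVolSharpM D hlog t tq M archPk archSub Ψ act Mmod region n lat sig split qData htq0 Sq htq1).thetaRegion3
          (Setting.labelSucc i) (Val.non u)) := by
    rw [thetaRegion3_settingPrVolSharpM, Set.image_preimage_eq _ (factorMapM_surjective D hlog (Setting.labelSucc i) (Val.non u))]
    exact (isHullSet_thetaBoxM_non D hlog t ht0 (Setting.labelSucc i) u).isNondegenerate
  change IsNondegenerate (factorFieldM D hlog (Setting.labelSucc i) (Val.non u))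
    (factorMapM D hlog (Setting.labelSucc i) (Val.non u) ''
      ⋃₀ (settingPrVolSharpM D hlog t tq M archPk archSub Ψ act Mmod region n lat sig split qData htq0 Sq htq1).thetaSlotImages
        (Setting.labelSucc i) (Val.non u))
  intro s
  obtain ⟨y, hy, hys⟩ := hnd s
  exact ⟨y, Set.image_mono (Set.subset_sUnion_of_mem ((settingPrVolSharpM D hlog t tq M archPk archSub Ψ act Mmod region n lat sig
    split qData htq0 Sq htq1).thetaRegion3_mem_thetaSlotImages (Setting.labelSucc i) (Val.non u))) hy, hys⟩

/-- **`SlotHullDefined` at every `(j, v_ℚ)`, `j ∈ 𝔽_l^⋇`**, for non-zero Θ-ideles (units off `Sθ`). [folklore] -/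
theorem slotHullDefined_settingPrVolSharpM (ht0 : ∀ u i x, t u i x ≠ 0) (Sθ : Finset (FinitePlace ℚ))
    (ht1 : ∀ (u : FinitePlace ℚ) (i : Fin (thetaIndexOfInitial D).lstar) (x : (thetaIndexOfInitial D).Fibre (Val.non u)),
      u ∉ Sθ → ‖t u i x‖ = 1)
    (i : Fin (thetaIndexOfInitial D).lstar) :
    ∀ vQ : (thetaIndexOfInitial D).VQ,
      (settingPrVolSharpM D hlog t tq M archPk archSub Ψ act Mmod region n lat sig split qData htq0 Sq htq1).SlotHullDefined
        (Setting.labelSucc i) vQ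
  | .inl w => slotHullDefined_settingPrVolSharpM_arc D hlog t tq M archPk archSub Ψ act Mmod region n lat sig split qData htq0 Sq htq1 _ w
  | .inr u => slotHullDefined_settingPrVolSharpM_non D hlog t tq M archPk archSub Ψ act Mmod region n lat sig split qData htq0 Sq htq1
      ht0 Sθ ht1 i u

/-- **The slot term vanishes at `v_ℚ = ∞`** (every region has log-volume `0` there, abc-iut-w4-d013 `logvol_situationPrVolM_arc`). [folklore] -/
theorem thetaSlotLocal_settingPrVolSharpM_arc_eq_zero (j : (thetaIndexOfInitial D).Label) (w : InfinitePlace ℚ) :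
    (settingPrVolSharpM D hlog t tq M archPk archSub Ψ act Mmod region n lat sig split qData htq0 Sq htq1).thetaSlotLocal j (Val.arc w) =
      ((0 : ℝ) : WithTop ℝ) := by
  rw [(settingPrVolSharpM D hlog t tq M archPk archSub Ψ act Mmod region n lat sig split qData htq0 Sq htq1).thetaSlotLocal_eq_coe
    (slotHullDefined_settingPrVolSharpM_arc D hlog t tq M archPk archSub Ψ act Mmod region n lat sig split qData htq0 Sq htq1 j w)]
  exact congrArg _ (by
    rw [settingPrVolSharpM_n]
    exact logvol_situationPrVolM_arc D hlog M archPk archSub Ψ act Mmod region n w j _)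

/-! ## §2. The two inequalities, the EQUALITY at the exact last-slot content family, and the orbit-hull form -/

/-- **`(−|log(Θ)|^{(P)}_{i+1,u}).untopD 0 ≤ Σ_{v⃗'} Pr(v⃗')·(−m(v⃗')·log p_u + log μ̄_{v⃗'}(hull(log_{p_u}(R_{v⃗'}^×))))`** at `settingPrVolSharpM` for ANY
integer family `m` bracketing the LAST-slot boxes (`hm0`; NO capsule symmetry, NO condition on the other slots): abc-iut-s2-p7's generic
`Cor312Vol.thetaSlotLocal_untopD_le_sum_content_hull` with `hframe := rfl`, `hvol := SummandPieces.logvol_preimage_pi`, `hmono` from abc-iut-s2-p8's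
`BridgeHyps`, region = product of the last-slot boxes. [cite: Mochizuki2012, IUTchIV Thm. 1.10 Step (v) p. 27–28] [cite: DupuyHilado2025, §3.9, §4.12] -/
theorem thetaSlotLocal_settingPrVolSharpM_untopD_le_sum_content_hull (ht0 : ∀ u i x, t u i x ≠ 0) (Sθ : Finset (FinitePlace ℚ))
    (ht1 : ∀ (u : FinitePlace ℚ) (i : Fin (thetaIndexOfInitial D).lstar) (x : (thetaIndexOfInitial D).Fibre (Val.non u)),
      u ∉ Sθ → ‖t u i x‖ = 1)
    (i : Fin (thetaIndexOfInitial D).lstar) (u : FinitePlace ℚ)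
    [Fintype ((thetaIndexOfInitial D).Fibre (Val.non u))]
    (m : ((thetaIndexOfInitial D).Caps (Setting.labelSucc i) → (thetaIndexOfInitial D).Fibre (Val.non u)) → ℤ)
    (hm0 : ∀ e : (thetaIndexOfInitial D).Caps (Setting.labelSucc i) → (thetaIndexOfInitial D).Fibre (Val.non u),
      iota (ratChar u) ((presAtM D hlog u).kk e) (Fin.last _) (t u i (e (Fin.last _))) •
          (normalizedPacket (ratChar u) ((presAtM D hlog u).kk e) : Set ((presAtM D hlog u).X e)) ⊆
        ((ratChar u : ℚ_[ratChar u]) ^ m e) • (logPacket (ratChar u) ((presAtM D hlog u).kk e) : Set ((presAtM D hlog u).X e))) :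
    ((settingPrVolSharpM D hlog t tq M archPk archSub Ψ act Mmod region n lat sig split qData htq0 Sq htq1).thetaSlotLocal
        (Setting.labelSucc i) (Val.non u)).untopD 0 ≤
      ∑ e : (thetaIndexOfInitial D).Caps (Setting.labelSucc i) → (thetaIndexOfInitial D).Fibre (Val.non u),
        weightM D u (Setting.labelSucc i) e * (-(m e * Real.log (ratChar u)) +
          packetLogμ (ratChar u) ((presAtM D hlog u).kk e)
            (packetHull (ratChar u) ((presAtM D hlog u).kk e)
              (logPacket (ratChar u) ((presAtM D hlog u).kk e) : Set ((presAtM D hlog u).X e)))) := by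
  letI : Fintype ((presAtM D hlog u).factorIdx (Setting.labelSucc i)) := factorIdxM_fintype D hlog (Setting.labelSucc i) (Val.non u)
  have h3 : (settingPrVolSharpM D hlog t tq M archPk archSub Ψ act Mmod region n lat sig split qData htq0 Sq htq1).thetaRegion3
      (Setting.labelSucc i) (Val.non u) ⊆
      (presAtM D hlog u).comparison (Setting.labelSucc i) ⁻¹' Set.pi univ fun e =>
        ((ratChar u : ℚ_[ratChar u]) ^ m e) • (logPacket (ratChar u) ((presAtM D hlog u).kk e) : Set ((presAtM D hlog u).X e)) := by
    rw [thetaRegion3_settingPrVolSharpM_eq_preimage_pi D hlog tq M archPk archSub Ψ act Mmod region n lat sig split qData htq0 Sq htq1 t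
      (Setting.labelSucc i) u]
    refine Set.preimage_mono (Set.pi_mono fun e _ => ?_)
    have hb : (presAtM D hlog u).sharpBox (t u) (Setting.labelSucc i) e =
        iota (ratChar u) ((presAtM D hlog u).kk e) (Fin.last _) (t u i (e (Fin.last _))) •
          (normalizedPacket (ratChar u) ((presAtM D hlog u).kk e) : Set ((presAtM D hlog u).X e)) := by
      rw [PadicPresentation.sharpBox, PadicPresentation.labelIdele_labelSucc]
    rw [hb]
    exact hm0 e
  exact Cor312Vol.thetaSlotLocal_untopD_le_sum_content_hull
    (P := settingPrVolSharpM D hlog t tq M archPk archSub Ψ act Mmod region n lat sig split qData htq0 Sq htq1) (presAtM D hlog u)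
    (bridgeHyps_settingPrVolSharpM_of_ideles D hlog t tq M archPk archSub Ψ act Mmod region n lat sig split qData htq0 Sq htq1
      ht0 Sθ ht1).mono
    i (slotHullDefined_settingPrVolSharpM_non D hlog t tq M archPk archSub Ψ act Mmod region n lat sig split qData htq0 Sq htq1 ht0 Sθ
      ht1 i u)
    (frame_settingPrVolSharpM_non D hlog t tq M archPk archSub Ψ act Mmod region n lat sig split qData htq0 Sq htq1 _ u)
    (fun R hR => by
      rw [settingPrVolSharpM_n]
      exact logvol_situationPrVolM_preimage_pi D hlog M archPk archSub Ψ act Mmod region n _ u R hR)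
    m h3

/-- The `WithTop` form of the upper bound: `−|log(Θ)|^{(P)}_{i+1,u} ≤ ↑(Σ_{v⃗'} Pr(v⃗')·(−m(v⃗')·log p_u + log μ̄_{v⃗'}(hull(log_{p_u}(R_{v⃗'}^×)))))`.
[cite: Mochizuki2012, IUTchIV Thm. 1.10 Step (v) p. 27–28] -/
theorem thetaSlotLocal_settingPrVolSharpM_le_sum_content_hull (ht0 : ∀ u i x, t u i x ≠ 0) (Sθ : Finset (FinitePlace ℚ))
    (ht1 : ∀ (u : FinitePlace ℚ) (i : Fin (thetaIndexOfInitial D).lstar) (x : (thetaIndexOfInitial D).Fibre (Val.non u)),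
      u ∉ Sθ → ‖t u i x‖ = 1)
    (i : Fin (thetaIndexOfInitial D).lstar) (u : FinitePlace ℚ)
    [Fintype ((thetaIndexOfInitial D).Fibre (Val.non u))]
    (m : ((thetaIndexOfInitial D).Caps (Setting.labelSucc i) → (thetaIndexOfInitial D).Fibre (Val.non u)) → ℤ)
    (hm0 : ∀ e : (thetaIndexOfInitial D).Caps (Setting.labelSucc i) → (thetaIndexOfInitial D).Fibre (Val.non u),
      iota (ratChar u) ((presAtM D hlog u).kk e) (Fin.last _) (t u i (e (Fin.last _))) •
          (normalizedPacket (ratChar u) ((presAtM D hlog u).kk e) : Set ((presAtM D hlog u).X e)) ⊆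
        ((ratChar u : ℚ_[ratChar u]) ^ m e) • (logPacket (ratChar u) ((presAtM D hlog u).kk e) : Set ((presAtM D hlog u).X e))) :
    (settingPrVolSharpM D hlog t tq M archPk archSub Ψ act Mmod region n lat sig split qData htq0 Sq htq1).thetaSlotLocal
        (Setting.labelSucc i) (Val.non u) ≤
      ((∑ e : (thetaIndexOfInitial D).Caps (Setting.labelSucc i) → (thetaIndexOfInitial D).Fibre (Val.non u),
        weightM D u (Setting.labelSucc i) e * (-(m e * Real.log (ratChar u)) +
          packetLogμ (ratChar u) ((presAtM D hlog u).kk e)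
            (packetHull (ratChar u) ((presAtM D hlog u).kk e)
              (logPacket (ratChar u) ((presAtM D hlog u).kk e) : Set ((presAtM D hlog u).X e)))) : ℝ) : WithTop ℝ) :=
  (settingPrVolSharpM D hlog t tq M archPk archSub Ψ act Mmod region n lat sig split qData htq0 Sq htq1).thetaSlotLocal_le_coe_of_untopD_le
    (slotHullDefined_settingPrVolSharpM_non D hlog t tq M archPk archSub Ψ act Mmod region n lat sig split qData htq0 Sq htq1 ht0 Sθ ht1 i u)
    (thetaSlotLocal_settingPrVolSharpM_untopD_le_sum_content_hull D hlog t tq M archPk archSub Ψ act Mmod region n lat sig split qData htq0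
      Sq htq1 ht0 Sθ ht1 i u m hm0)

/-- **`Σ_{v⃗'} Pr(v⃗')·(−m(v⃗')·log p_u + log μ̄_{v⃗'}(hull(log_{p_u}(R_{v⃗'}^×)))) ≤ (−|log(Θ)|^{(P)}_{i+1,u}).untopD 0`** at `settingPrVolSharpM` for the EXACT
content family `m` of the LAST-slot boxes (`hm0`/`hm1`): abc-iut-s2-p7's generic `Cor312Vol.sum_content_hull_le_thetaSlotLocal_untopD` with `hism` from
the FULLNESS of Ism at the genuine carriers (abc-iut-s2-p9 `exists_ism_presAtM_of_image_logUnits_eq`, through `exists_ind2Family_comparison_eq_congr`)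
and `hwit` from the product of the last-slot boxes (`exists_mem_thetaRegion3_exact_content_of_sharpBox` on abc-iut-s2-p9's
`thetaRegion3_settingPrVolSharpM_eq_preimage_pi`). [cite: Mochizuki2012, IUTchIII Thm. 3.11 (i) (Ind2) p. 154; Cor. 3.12 proof Step (x) p. 181]
[cite: DupuyHilado2025, §4.9, §4.12] -/
theorem sum_content_hull_le_thetaSlotLocal_settingPrVolSharpM_untopD (ht0 : ∀ u i x, t u i x ≠ 0) (Sθ : Finset (FinitePlace ℚ))
    (ht1 : ∀ (u : FinitePlace ℚ) (i : Fin (thetaIndexOfInitial D).lstar) (x : (thetaIndexOfInitial D).Fibre (Val.non u)),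
      u ∉ Sθ → ‖t u i x‖ = 1)
    (i : Fin (thetaIndexOfInitial D).lstar) (u : FinitePlace ℚ)
    [Fintype ((thetaIndexOfInitial D).Fibre (Val.non u))]
    (m : ((thetaIndexOfInitial D).Caps (Setting.labelSucc i) → (thetaIndexOfInitial D).Fibre (Val.non u)) → ℤ)
    (hm0 : ∀ e : (thetaIndexOfInitial D).Caps (Setting.labelSucc i) → (thetaIndexOfInitial D).Fibre (Val.non u),
      iota (ratChar u) ((presAtM D hlog u).kk e) (Fin.last _) (t u i (e (Fin.last _))) •
          (normalizedPacket (ratChar u) ((presAtM D hlog u).kk e) : Set ((presAtM D hlog u).X e)) ⊆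
        ((ratChar u : ℚ_[ratChar u]) ^ m e) • (logPacket (ratChar u) ((presAtM D hlog u).kk e) : Set ((presAtM D hlog u).X e)))
    (hm1 : ∀ e : (thetaIndexOfInitial D).Caps (Setting.labelSucc i) → (thetaIndexOfInitial D).Fibre (Val.non u),
      ¬ iota (ratChar u) ((presAtM D hlog u).kk e) (Fin.last _) (t u i (e (Fin.last _))) •
          (normalizedPacket (ratChar u) ((presAtM D hlog u).kk e) : Set ((presAtM D hlog u).X e)) ⊆
        ((ratChar u : ℚ_[ratChar u]) ^ (m e + 1)) • (logPacket (ratChar u) ((presAtM D hlog u).kk e) : Set ((presAtM D hlog u).X e))) :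
    ∑ e : (thetaIndexOfInitial D).Caps (Setting.labelSucc i) → (thetaIndexOfInitial D).Fibre (Val.non u),
        weightM D u (Setting.labelSucc i) e * (-(m e * Real.log (ratChar u)) +
          packetLogμ (ratChar u) ((presAtM D hlog u).kk e)
            (packetHull (ratChar u) ((presAtM D hlog u).kk e)
              (logPacket (ratChar u) ((presAtM D hlog u).kk e) : Set ((presAtM D hlog u).X e)))) ≤
      ((settingPrVolSharpM D hlog t tq M archPk archSub Ψ act Mmod region n lat sig split qData htq0 Sq htq1).thetaSlotLocal
        (Setting.labelSucc i) (Val.non u)).untopD 0 := by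
  classical
  letI : Fintype ((presAtM D hlog u).factorIdx (Setting.labelSucc i)) := factorIdxM_fintype D hlog (Setting.labelSucc i) (Val.non u)
  have h := Cor312Vol.sum_content_hull_le_thetaSlotLocal_untopD
    (P := settingPrVolSharpM D hlog t tq M archPk archSub Ψ act Mmod region n lat sig split qData htq0 Sq htq1) (presAtM D hlog u) i
    (slotHullDefined_settingPrVolSharpM_non D hlog t tq M archPk archSub Ψ act Mmod region n lat sig split qData htq0 Sq htq1 ht0 Sθ
      ht1 i u)
    (frame_settingPrVolSharpM_non D hlog t tq M archPk archSub Ψ act Mmod region n lat sig split qData htq0 Sq htq1 _ u)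
    (fun R hR => by
      rw [settingPrVolSharpM_n]
      exact logvol_situationPrVolM_preimage_pi D hlog M archPk archSub Ψ act Mmod region n _ u R hR)
    m
    (fun e => exists_mem_thetaRegion3_exact_content_of_sharpBox
      (P := settingPrVolSharpM D hlog t tq M archPk archSub Ψ act Mmod region n lat sig split qData htq0 Sq htq1) (presAtM D hlog u)
      (t u) i
      (thetaRegion3_settingPrVolSharpM_eq_preimage_pi D hlog tq M archPk archSub Ψ act Mmod region n lat sig split qData htq0 Sq htq1 t
        (Setting.labelSucc i) u)
      e (m e) (hm0 e) (hm1 e))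
    (fun e g' hg' => exists_ind2Family_comparison_eq_congr (S := situationPrVolM D hlog M archPk archSub Ψ act Mmod region)
      (presAtM D hlog u) (Setting.labelSucc i) (fun v g'' hg'' => exists_ism_presAtM_of_image_logUnits_eq D hlog u v g'' hg'') e g' hg')
  refine (le_of_eq (Finset.sum_congr rfl fun e _ => ?_)).trans h
  rfl

/-- **THE LOCAL SLOT TERM IS PINNED: `−|log(Θ)|^{(P)}_{i+1,u} = ↑(Σ_{v⃗'} Pr(v⃗')·(−m(v⃗')·log p_u + log μ̄_{v⃗'}(hull(log_{p_u}(R_{v⃗'}^×)))))`** at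
`settingPrVolSharpM` for the EXACT content family `m` of the LAST-slot boxes (every non-zero Θ-ideles / `q`-ideles, units off finite sets) — the two
inequalities above; the M-level twin of abc-iut-s2-p7's `thetaSlotLocal_settingPrVolSharp_eq_sum_content_hull`. [cite: Mochizuki2012, IUTchIII Cor. 3.12
proof Step (x) p. 181] [cite: Mochizuki2012, IUTchIV Thm. 1.10 Step (v) p. 27–28] [cite: DupuyHilado2025, §4.9, §4.12] -/
theorem thetaSlotLocal_settingPrVolSharpM_eq_sum_content_hull (ht0 : ∀ u i x, t u i x ≠ 0) (Sθ : Finset (FinitePlace ℚ))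
    (ht1 : ∀ (u : FinitePlace ℚ) (i : Fin (thetaIndexOfInitial D).lstar) (x : (thetaIndexOfInitial D).Fibre (Val.non u)),
      u ∉ Sθ → ‖t u i x‖ = 1)
    (i : Fin (thetaIndexOfInitial D).lstar) (u : FinitePlace ℚ)
    [Fintype ((thetaIndexOfInitial D).Fibre (Val.non u))]
    (m : ((thetaIndexOfInitial D).Caps (Setting.labelSucc i) → (thetaIndexOfInitial D).Fibre (Val.non u)) → ℤ)
    (hm0 : ∀ e : (thetaIndexOfInitial D).Caps (Setting.labelSucc i) → (thetaIndexOfInitial D).Fibre (Val.non u),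
      iota (ratChar u) ((presAtM D hlog u).kk e) (Fin.last _) (t u i (e (Fin.last _))) •
          (normalizedPacket (ratChar u) ((presAtM D hlog u).kk e) : Set ((presAtM D hlog u).X e)) ⊆
        ((ratChar u : ℚ_[ratChar u]) ^ m e) • (logPacket (ratChar u) ((presAtM D hlog u).kk e) : Set ((presAtM D hlog u).X e)))
    (hm1 : ∀ e : (thetaIndexOfInitial D).Caps (Setting.labelSucc i) → (thetaIndexOfInitial D).Fibre (Val.non u),
      ¬ iota (ratChar u) ((presAtM D hlog u).kk e) (Fin.last _) (t u i (e (Fin.last _))) •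
          (normalizedPacket (ratChar u) ((presAtM D hlog u).kk e) : Set ((presAtM D hlog u).X e)) ⊆
        ((ratChar u : ℚ_[ratChar u]) ^ (m e + 1)) • (logPacket (ratChar u) ((presAtM D hlog u).kk e) : Set ((presAtM D hlog u).X e))) :
    (settingPrVolSharpM D hlog t tq M archPk archSub Ψ act Mmod region n lat sig split qData htq0 Sq htq1).thetaSlotLocal
        (Setting.labelSucc i) (Val.non u) =
      ((∑ e : (thetaIndexOfInitial D).Caps (Setting.labelSucc i) → (thetaIndexOfInitial D).Fibre (Val.non u),
        weightM D u (Setting.labelSucc i) e * (-(m e * Real.log (ratChar u)) +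
          packetLogμ (ratChar u) ((presAtM D hlog u).kk e)
            (packetHull (ratChar u) ((presAtM D hlog u).kk e)
              (logPacket (ratChar u) ((presAtM D hlog u).kk e) : Set ((presAtM D hlog u).X e)))) : ℝ) : WithTop ℝ) :=
  le_antisymm
    (thetaSlotLocal_settingPrVolSharpM_le_sum_content_hull D hlog t tq M archPk archSub Ψ act Mmod region n lat sig split qData htq0 Sq htq1
      ht0 Sθ ht1 i u m hm0)
    ((settingPrVolSharpM D hlog t tq M archPk archSub Ψ act Mmod region n lat sig split qData htq0 Sq htq1).coe_le_thetaSlotLocal_of_le_untopD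
      (slotHullDefined_settingPrVolSharpM_non D hlog t tq M archPk archSub Ψ act Mmod region n lat sig split qData htq0 Sq htq1 ht0 Sθ ht1 i u)
      (sum_content_hull_le_thetaSlotLocal_settingPrVolSharpM_untopD D hlog t tq M archPk archSub Ψ act Mmod region n lat sig split qData htq0
        Sq htq1 ht0 Sθ ht1 i u m hm0 hm1))

/-- **THE ORBIT-HULL FORM, HYPOTHESIS-FREE: `−|log(Θ)|^{(P)}_{i+1,u} = ↑(Σ_{v⃗'} Pr(v⃗')·log μ̄_{v⃗'}(hull(⋃_{g ∈ Ind2} g·ι_{i+1}(t_{Θ,i+1,v̲'_{i+1}})·(R_I)^∼)))`**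
at `settingPrVolSharpM` (every non-zero Θ-ideles / `q`-ideles, units off finite sets): the last-slot box contains the non-zero `ι_{i+1}(t)` and is
`ψ`-bounded, so it HAS an exact content `m` (abc-iut-c312-3 `exists_content`); the orbit hull of a region of exact content `m` is `hull(p^m·log_p(R_I^×))`
(abc-iut-w5-d180 `packetHull_orbit_eq_zpow`). Summand by summand this is Dupuy–Hilado's PER-SLOT-IMAGE shape (abc-iut-S7 `PrimePacket.slotImagesHull`)
at the genuine carriers `K_{v̲}`; the M-level twin of abc-iut-s2-p7's `thetaSlotLocal_settingPrVolSharp_eq_sum_orbitHull`.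
[cite: Mochizuki2012, IUTchIII Thm. 3.11 (i) (Ind2) p. 154; Cor. 3.12 proof Step (x) p. 181] [cite: Mochizuki2012, IUTchIV Thm. 1.10 Step (v) p. 27–28]
[cite: DupuyHilado2025, §4.9, §4.11–4.12] -/
theorem thetaSlotLocal_settingPrVolSharpM_eq_sum_orbitHull (ht0 : ∀ u i x, t u i x ≠ 0) (Sθ : Finset (FinitePlace ℚ))
    (ht1 : ∀ (u : FinitePlace ℚ) (i : Fin (thetaIndexOfInitial D).lstar) (x : (thetaIndexOfInitial D).Fibre (Val.non u)),
      u ∉ Sθ → ‖t u i x‖ = 1)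
    (i : Fin (thetaIndexOfInitial D).lstar) (u : FinitePlace ℚ)
    [Fintype ((thetaIndexOfInitial D).Fibre (Val.non u))] :
    (settingPrVolSharpM D hlog t tq M archPk archSub Ψ act Mmod region n lat sig split qData htq0 Sq htq1).thetaSlotLocal
        (Setting.labelSucc i) (Val.non u) =
      ((∑ e : (thetaIndexOfInitial D).Caps (Setting.labelSucc i) → (thetaIndexOfInitial D).Fibre (Val.non u),
          weightM D u (Setting.labelSucc i) e *
            packetLogμ (ratChar u) ((presAtM D hlog u).kk e)
              (packetHull (ratChar u) ((presAtM D hlog u).kk e)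
                (⋃ g : indTwo (ratChar u) ((presAtM D hlog u).kk e),
                  g • iota (ratChar u) ((presAtM D hlog u).kk e) (Fin.last _) (t u i (e (Fin.last _))) •
                    (normalizedPacket (ratChar u) ((presAtM D hlog u).kk e) : Set ((presAtM D hlog u).X e)))) : ℝ) :
        WithTop ℝ) := by
  -- the last-slot box at each tuple contains the non-zero vector `ι_{i+1}(t)`, so it has an exact content, chosen
  have hne : ∀ e : (thetaIndexOfInitial D).Caps (Setting.labelSucc i) → (thetaIndexOfInitial D).Fibre (Val.non u),
      ∃ x ∈ iota (ratChar u) ((presAtM D hlog u).kk e) (Fin.last _) (t u i (e (Fin.last _))) •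
          (normalizedPacket (ratChar u) ((presAtM D hlog u).kk e) : Set ((presAtM D hlog u).X e)), x ≠ 0 := by
    intro e
    refine ⟨iota (ratChar u) ((presAtM D hlog u).kk e) (Fin.last _) (t u i (e (Fin.last _))), ?_,
      (map_ne_zero (iota (ratChar u) ((presAtM D hlog u).kk e) (Fin.last _))).mpr (ht0 u i _)⟩
    have h := Set.smul_mem_smul_set (a := iota (ratChar u) ((presAtM D hlog u).kk e) (Fin.last _) (t u i (e (Fin.last _))))
      (Subring.one_mem (normalizedPacket (ratChar u) ((presAtM D hlog u).kk e)) : (1 : (presAtM D hlog u).X e) ∈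
        (normalizedPacket (ratChar u) ((presAtM D hlog u).kk e) : Set ((presAtM D hlog u).X e)))
    rwa [smul_eq_mul, mul_one] at h
  have h := fun e : (thetaIndexOfInitial D).Caps (Setting.labelSucc i) → (thetaIndexOfInitial D).Fibre (Val.non u) =>
    exists_content (ratChar u) ((presAtM D hlog u).kk e) (isPsiBounded_smul_normalizedPacket (ratChar u) ((presAtM D hlog u).kk e) _) (hne e)
  choose m hm0 hm1 using h
  rw [thetaSlotLocal_settingPrVolSharpM_eq_sum_content_hull D hlog t tq M archPk archSub Ψ act Mmod region n lat sig split qData htq0 Sq htq1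
    ht0 Sθ ht1 i u m hm0 hm1]
  congr 1
  refine Finset.sum_congr rfl fun e _ => ?_
  obtain ⟨x, hxM, hx⟩ := Set.not_subset.mp (hm1 e)
  rw [packetHull_orbit_eq_zpow (ratChar u) ((presAtM D hlog u).kk e) hxM hx (hm0 e),
    packetLogμ_packetHull_zpow_smul_logPacket (ratChar u) ((presAtM D hlog u).kk e) (m e)]

end Summit.ABC.IUTFork.Thm311.Real

end
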